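import Mathlib
import Summits.Ventures.PercRepro2.Defs
import Summits.Ventures.PercRepro2.Independence
import Summits.Ventures.PercRepro2.Harris
import Summits.Ventures.PercRepro2.CoinDefs
import Summits.Ventures.PercRepro2.CoinArcsOff
import Summits.Ventures.PercRepro2.CoinPendantDefs
import Summits.Ventures.PercRepro2.CoinPendant
import Summits.Ventures.PercRepro2.CoinInduced
import Summits.Ventures.PercRepro2.CoinVdBK
import Summits.Ventures.PercRepro2.CoinBHK
import Summits.Ventures.PercRepro2.CoinReverse
import Summits.Ventures.PercRepro2.CoinLemmaA
import Summits.Ventures.PercRepro2.CoinDarcMixed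
import Summits.Ventures.PercRepro2.CoinTwoPendantDefs
import Summits.Ventures.PercRepro2.CoinTwoPendantMass
import Summits.Ventures.PercRepro2.CoinTraceLevels
import Summits.Ventures.PercRepro2.CoinTraceTower
import Summits.Ventures.PercRepro2.CoinTracePin
import Summits.Ventures.PercRepro2.CoinTracePin2
import Summits.Ventures.PercRepro2.CoinTracePinTransfer
import Summits.Ventures.PercRepro2.CoinTraceReduce
import Summits.Ventures.PercRepro2.CoinTraceFn
import Summits.Ventures.PercRepro2.CoinTraceBlock
import Summits.Ventures.PercRepro2.CoinTraceShift
import Summits.Ventures.PercRepro2.CoinTwoStarAbstract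
import Summits.Ventures.PercRepro2.CoinTwoStar
import Summits.Ventures.PercRepro2.CoinTraceBlocks
import Summits.Ventures.PercRepro2.CoinTraceBlocks2
import Summits.Ventures.PercRepro2.CoinPathStarAbstract
import Summits.Ventures.PercRepro2.CoinPathStar
import Summits.Ventures.PercRepro2.CoinPathStarHard
import Summits.Ventures.PercRepro2.CoinPathStarAbstract2
import Summits.Ventures.PercRepro2.CoinPathStarAll
import Summits.Ventures.PercRepro2.CoinTwoChainsAbstract
import Summits.Ventures.PercRepro2.CoinTwoChains
import Summits.Ventures.PercRepro2.CoinLayerCake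
import Summits.Ventures.PercRepro2.CoinTwoChainsHard
import Summits.Ventures.PercRepro2.CoinTwoChainsHardCD
import Summits.Ventures.PercRepro2.CoinTwoChainsAbstract2
import Summits.Ventures.PercRepro2.CoinTwoChainsAll
import Summits.Ventures.PercRepro2.CoinPivotalPair
import Summits.Ventures.PercRepro2.CoinPivotalPairForce
import Summits.Ventures.PercRepro2.CoinContract
import Summits.Ventures.PercRepro2.CoinContractDarc

/-!
# The PATHSTAR and TWO-CHAINS heads on ALL regimes with a TARGET SET (blind cell PercRepro2,
night-2 g4; proofs/NIGHT2-DARC.md §24.3)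

`darc_of_pathStar_mixed_set`, `darc_of_twoChains_mixed_set`: the single-target theorems
`darc_of_pathStar_mixed` / `darc_of_twoChains_mixed` transported through the contraction of the
target set `T` to `t₀` (`darc_contract_iff`, CoinContractDarc.lean), exactly as
`darc_of_twoStar_mixed_set`.
-/

namespace Summit.Ventures.PercRepro2.Coin

section PathStarSet

open Classical

variable {V : Type*} {E : Type*} [Fintype V] [DecidableEq V] [Fintype E] [DecidableEq E]
  {R : Type*} [Field R] [LinearOrder R] [IsStrictOrderedRing R]

/-- **THEOREM (the pathstar head, ALL regimes, target SET).** -/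
theorem darc_of_pathStar_mixed_set (p : E → R) (hp : IsProbVec p) {arcs : E → Finset (V × V)}
    (hS : SameEnds arcs) (s a b u w v₁ v₂ v₃ : V) {T : Finset V} {t₀ : V} (ht₀ : t₀ ∈ T)
    (hwv₁ : w ≠ v₁) (hwv₂ : w ≠ v₂) (hwv₃ : w ≠ v₃) (hv₁₂ : v₁ ≠ v₂) (hv₁₃ : v₁ ≠ v₃)
    (hv₂₃ : v₂ ≠ v₃) (hPT : Disjoint ({w, v₁, v₂, v₃} : Finset V) T) (hs : s ∉ T)
    (hclosed : ClosedOut arcs {w, v₁, v₂, v₃} T) (hT : TailCoinsIn arcs {w, v₁, v₂, v₃} T)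
    {e₂ e₃ e₅ : E} (hne₂₃ : e₂ ≠ e₃) (hc₂ : e₂ ∈ tailCoins arcs {w, v₁, v₂, v₃})
    (hc₃ : e₃ ∈ tailCoins arcs {w, v₁, v₂, v₃}) (hc₅ : e₅ ∈ tailCoins arcs {w, v₁, v₂, v₃})
    (hleaf₁ : bwdEvent arcs v₁ T = openEdge e₂ ∩ openEdge e₃)
    (hleaf₂ : bwdEvent arcs v₂ T = openEdge e₃) (hleaf₃ : bwdEvent arcs v₃ T = openEdge e₅)
    (himp : ∀ ω : Config E, ω ∈ bwdEvent arcs v₁ T → ω ∈ bwdEvent arcs v₂ T)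
    (hexit : ∀ ω : Config E, ω ∈ bwdEvent arcs w T →
      (ω ∈ bwdEvent arcs v₁ T ∧ ω ∈ bwdEvent arcs v₂ T) ∨ ω ∈ bwdEvent arcs v₃ T)
    (ha : a ∉ ({w, v₁, v₂, v₃} : Finset V) ∪ T) (hb : b ∉ ({w, v₁, v₂, v₃} : Finset V) ∪ T)
    (hu : u ∉ ({w, v₁, v₂, v₃} : Finset V) ∪ T)
    (hP : ∀ Z ∈ ({w, v₁, v₂, v₃} : Finset V).powerset,
      0 < prob p (avoidEvent (arcsOff arcs ({w, v₁, v₂, v₃} ∪ T)) s (Z ∪ T)))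
    (hQ : ∀ Z ∈ ({w, v₁, v₂, v₃} : Finset V).powerset,
      0 < prob p (avoidEvent (arcsOff arcs ({w, v₁, v₂, v₃} ∪ T)) s (gateTarget u w Z T))) :
    DARC p arcs s T a b u w := by
  have hwT : w ∉ T := Finset.disjoint_left.mp hPT (by simp)
  have hv₁T : v₁ ∉ T := Finset.disjoint_left.mp hPT (by simp)
  have hv₂T : v₂ ∉ T := Finset.disjoint_left.mp hPT (by simp)
  have hv₃T : v₃ ∉ T := Finset.disjoint_left.mp hPT (by simp)
  have haT : a ∉ T := fun h => ha (Finset.mem_union_right _ h)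
  have hbT : b ∉ T := fun h => hb (Finset.mem_union_right _ h)
  have huT : u ∉ T := fun h => hu (Finset.mem_union_right _ h)
  rw [darc_contract_iff p ht₀ hs haT hbT huT hwT]
  refine darc_of_pathStar_mixed (e₂ := e₂) (e₃ := e₃) (e₅ := e₅) p hp (sameEnds_contract hS)
    s a b u w v₁ v₂ v₃ t₀ hwv₁ hwv₂ hwv₃ hv₁₂ hv₁₃ hv₂₃ (closedOut_contract ht₀ hPT hclosed)
    (tailCoinsIn_contract ht₀ hPT hT) hne₂₃ (by rwa [tailCoins_contract ht₀ hPT])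
    (by rwa [tailCoins_contract ht₀ hPT]) (by rwa [tailCoins_contract ht₀ hPT])
    (by rw [← bwdEvent_contract ht₀ hv₁T]; exact hleaf₁)
    (by rw [← bwdEvent_contract ht₀ hv₂T]; exact hleaf₂)
    (by rw [← bwdEvent_contract ht₀ hv₃T]; exact hleaf₃)
    (by rw [← bwdEvent_contract ht₀ hv₁T, ← bwdEvent_contract ht₀ hv₂T]; exact himp)
    (by rw [← bwdEvent_contract ht₀ hwT, ← bwdEvent_contract ht₀ hv₁T,
      ← bwdEvent_contract ht₀ hv₂T, ← bwdEvent_contract ht₀ hv₃T]; exact hexit)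
    ?_ ?_ ?_ ?_ ?_
  · intro h
    rcases Finset.mem_union.mp h with h | h
    · exact ha (Finset.mem_union_left _ h)
    · exact haT (Finset.mem_singleton.mp h ▸ ht₀)
  · intro h
    rcases Finset.mem_union.mp h with h | h
    · exact hb (Finset.mem_union_left _ h)
    · exact hbT (Finset.mem_singleton.mp h ▸ ht₀)
  · intro h
    rcases Finset.mem_union.mp h with h | h
    · exact hu (Finset.mem_union_left _ h)
    · exact huT (Finset.mem_singleton.mp h ▸ ht₀)
  · intro Z hZ
    rw [avoid_reduced_contract ht₀ hPT hs (Finset.mem_powerset.mp hZ)]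
    exact hP Z hZ
  · intro Z hZ
    rw [avoid_reduced_gate_contract ht₀ hPT hs huT (Finset.mem_powerset.mp hZ)]
    exact hQ Z hZ

/-- **THEOREM (two chains of length 2, ALL regimes, target SET).** -/
theorem darc_of_twoChains_mixed_set (p : E → R) (hp : IsProbVec p) {arcs : E → Finset (V × V)}
    (hS : SameEnds arcs) (s a b u w v₁ v₂ v₃ v₄ : V) {T : Finset V} {t₀ : V} (ht₀ : t₀ ∈ T)
    (hwv₁ : w ≠ v₁) (hwv₂ : w ≠ v₂) (hwv₃ : w ≠ v₃) (hwv₄ : w ≠ v₄) (hv₁₂ : v₁ ≠ v₂)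
    (hv₁₃ : v₁ ≠ v₃) (hv₁₄ : v₁ ≠ v₄) (hv₂₃ : v₂ ≠ v₃) (hv₂₄ : v₂ ≠ v₄) (hv₃₄ : v₃ ≠ v₄)
    (hPT : Disjoint ({w, v₁, v₂, v₃, v₄} : Finset V) T) (hs : s ∉ T)
    (hclosed : ClosedOut arcs {w, v₁, v₂, v₃, v₄} T) (hT : TailCoinsIn arcs {w, v₁, v₂, v₃, v₄} T)
    {e₂ e₃ e₅ e₆ : E} (hne₂₃ : e₂ ≠ e₃) (hne₅₆ : e₅ ≠ e₆)
    (hc₂ : e₂ ∈ tailCoins arcs {w, v₁, v₂, v₃, v₄}) (hc₃ : e₃ ∈ tailCoins arcs {w, v₁, v₂, v₃, v₄})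
    (hc₅ : e₅ ∈ tailCoins arcs {w, v₁, v₂, v₃, v₄}) (hc₆ : e₆ ∈ tailCoins arcs {w, v₁, v₂, v₃, v₄})
    (hleaf₁ : bwdEvent arcs v₁ T = openEdge e₂ ∩ openEdge e₃)
    (hleaf₂ : bwdEvent arcs v₂ T = openEdge e₃)
    (hleaf₃ : bwdEvent arcs v₃ T = openEdge e₅ ∩ openEdge e₆)
    (hleaf₄ : bwdEvent arcs v₄ T = openEdge e₆)
    (himp₁₂ : ∀ ω : Config E, ω ∈ bwdEvent arcs v₁ T → ω ∈ bwdEvent arcs v₂ T)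
    (himp₃₄ : ∀ ω : Config E, ω ∈ bwdEvent arcs v₃ T → ω ∈ bwdEvent arcs v₄ T)
    (hexit : ∀ ω : Config E, ω ∈ bwdEvent arcs w T →
      (ω ∈ bwdEvent arcs v₁ T ∧ ω ∈ bwdEvent arcs v₂ T) ∨
        (ω ∈ bwdEvent arcs v₃ T ∧ ω ∈ bwdEvent arcs v₄ T))
    (ha : a ∉ ({w, v₁, v₂, v₃, v₄} : Finset V) ∪ T) (hb : b ∉ ({w, v₁, v₂, v₃, v₄} : Finset V) ∪ T)
    (hu : u ∉ ({w, v₁, v₂, v₃, v₄} : Finset V) ∪ T)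
    (hP : ∀ Z ∈ ({w, v₁, v₂, v₃, v₄} : Finset V).powerset,
      0 < prob p (avoidEvent (arcsOff arcs ({w, v₁, v₂, v₃, v₄} ∪ T)) s (Z ∪ T)))
    (hQ : ∀ Z ∈ ({w, v₁, v₂, v₃, v₄} : Finset V).powerset,
      0 < prob p (avoidEvent (arcsOff arcs ({w, v₁, v₂, v₃, v₄} ∪ T)) s (gateTarget u w Z T))) :
    DARC p arcs s T a b u w := by
  have hwT : w ∉ T := Finset.disjoint_left.mp hPT (by simp)
  have hv₁T : v₁ ∉ T := Finset.disjoint_left.mp hPT (by simp)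
  have hv₂T : v₂ ∉ T := Finset.disjoint_left.mp hPT (by simp)
  have hv₃T : v₃ ∉ T := Finset.disjoint_left.mp hPT (by simp)
  have hv₄T : v₄ ∉ T := Finset.disjoint_left.mp hPT (by simp)
  have haT : a ∉ T := fun h => ha (Finset.mem_union_right _ h)
  have hbT : b ∉ T := fun h => hb (Finset.mem_union_right _ h)
  have huT : u ∉ T := fun h => hu (Finset.mem_union_right _ h)
  rw [darc_contract_iff p ht₀ hs haT hbT huT hwT]
  refine darc_of_twoChains_mixed (e₂ := e₂) (e₃ := e₃) (e₅ := e₅) (e₆ := e₆) p hp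
    (sameEnds_contract hS) s a b u w v₁ v₂ v₃ v₄ t₀ hwv₁ hwv₂ hwv₃ hwv₄ hv₁₂ hv₁₃ hv₁₄ hv₂₃ hv₂₄
    hv₃₄ (closedOut_contract ht₀ hPT hclosed) (tailCoinsIn_contract ht₀ hPT hT) hne₂₃ hne₅₆
    (by rwa [tailCoins_contract ht₀ hPT]) (by rwa [tailCoins_contract ht₀ hPT])
    (by rwa [tailCoins_contract ht₀ hPT]) (by rwa [tailCoins_contract ht₀ hPT])
    (by rw [← bwdEvent_contract ht₀ hv₁T]; exact hleaf₁)
    (by rw [← bwdEvent_contract ht₀ hv₂T]; exact hleaf₂)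
    (by rw [← bwdEvent_contract ht₀ hv₃T]; exact hleaf₃)
    (by rw [← bwdEvent_contract ht₀ hv₄T]; exact hleaf₄)
    (by rw [← bwdEvent_contract ht₀ hv₁T, ← bwdEvent_contract ht₀ hv₂T]; exact himp₁₂)
    (by rw [← bwdEvent_contract ht₀ hv₃T, ← bwdEvent_contract ht₀ hv₄T]; exact himp₃₄)
    (by rw [← bwdEvent_contract ht₀ hwT, ← bwdEvent_contract ht₀ hv₁T,
      ← bwdEvent_contract ht₀ hv₂T, ← bwdEvent_contract ht₀ hv₃T,
      ← bwdEvent_contract ht₀ hv₄T]; exact hexit)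
    ?_ ?_ ?_ ?_ ?_
  · intro h
    rcases Finset.mem_union.mp h with h | h
    · exact ha (Finset.mem_union_left _ h)
    · exact haT (Finset.mem_singleton.mp h ▸ ht₀)
  · intro h
    rcases Finset.mem_union.mp h with h | h
    · exact hb (Finset.mem_union_left _ h)
    · exact hbT (Finset.mem_singleton.mp h ▸ ht₀)
  · intro h
    rcases Finset.mem_union.mp h with h | h
    · exact hu (Finset.mem_union_left _ h)
    · exact huT (Finset.mem_singleton.mp h ▸ ht₀)
  · intro Z hZ
    rw [avoid_reduced_contract ht₀ hPT hs (Finset.mem_powerset.mp hZ)]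
    exact hP Z hZ
  · intro Z hZ
    rw [avoid_reduced_gate_contract ht₀ hPT hs huT (Finset.mem_powerset.mp hZ)]
    exact hQ Z hZ

end PathStarSet

end Summit.Ventures.PercRepro2.Coin
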